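import Literature.NumberTheory.EllipticCurves.SigmaEulerData
import Literature.NumberTheory.EllipticCurves.ZpExtensionUnramifiedProofs
import Literature.NumberTheory.GaloisRepresentations.AbsGaloisOuterConj
import Literature.NumberTheory.GaloisRepresentations.DecompositionGroupOfCompletion
import Literature.NumberTheory.GaloisRepresentations.IntegralGaloisActionProofs
import Literature.NumberTheory.Automorphic.AdicCompletionResidueCard
import HarnessLib

/-!
# A prime of `K` stable under `Gal(K/ℚ)` — e.g. an INERT rational prime `(ℓ) = ℓ𝓞_K` — is totally split in every
# anticyclotomic `ℤ_p`-extension: `c_λ = κ(Frob_λ) = 0` and `D_λ ≤ ker κ` (proofs file)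

Topic `NumberTheory/EllipticCurves` (next to `AnticyclotomicPrimeDecomposition*`, `SigmaEulerData` §2/§7).
THEOREMS ONLY: no definition, no named fact, no instance, no `sorry`.

## The statement and its printed source

D. Brink, *Prime decomposition in the anti-cyclotomic extension*, Math. Comp. 76 (2007) 2127–2138, §III
(p. 2134): a prime of the imaginary quadratic `K` over a rational prime INERT or RAMIFIED in `K` splits totally
in `K^anti` (quoted in the tree's `AnticyclotomicPrimeDecomposition.lean`, where only the SPLIT case — Brink's
Thm. 2, finitely decomposed — was vendored); Pollack–Weston (2011) Lemma 3.2 / Howard 2004 §1.2 use it in the form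
«an inert Kolyvagin prime `λ = (ℓ)` splits completely in `K_∞`». The proof is the generalised-dihedral argument:
`Gal(K_∞/ℚ) = Γ ⋊ ⟨c⟩` with `c γ c⁻¹ = γ⁻¹` (`ZpExtension.IsAnticyclotomic`); if `c` fixes the place `λ`, then
conjugating an arithmetic Frobenius `Φ` at a prime `𝔓 ∣ λ` of `\bar ℤ_K` by a lift `c₀ ∈ Γ_ℚ` of `c` gives an
arithmetic Frobenius at the prime `c₀ ⋆ 𝔓`, which lies over `c̄ • λ = λ` again
(`isArithFrobAt_absGaloisOuterConj_iff`, `outerConjIdeal_mem_primesAbove`); `κ` takes the SAME value on all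
arithmetic Frobenii above the unramified place `λ ∤ p` (they are `Γ_K`-conjugate up to inertia, on which `κ`
vanishes: `exists_smul_eq_of_mem_primesAbove_holds`, `IsArithFrobAt.conj`, `IsArithFrobAt.mul_inv_mem_inertia`,
`ZpExtension.inertia_le_kerSubgroup_holds`) and the INVERSE value by anticyclotomy — so `κ(Φ)² = 1`, `κ(Φ) = 1`
in the torsion-free `ℤ_p`, i.e. `c_λ = 0`; then `D_λ ≤ ker κ` is the tree's
`ZpExtension.decomp_le_kerSubgroup_of_frobExponentAt_eq_zero`.

## What is proved (namespace `Literature.NumberTheory.EllipticCurves.ZpExtension`)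

* §1 `apply_eq_of_isArithFrobAt` — for ANY `ℤ_p`-extension `κ` and a place `w ∤ p`: `κ Φ = κ Φ'` for arithmetic
  Frobenii `Φ, Φ'` at any two primes `𝔓, 𝔓'` of `\bar ℤ_K` above `w`;
  `apply_eq_frobExponentAt_of_isArithFrobAt` — `κ Φ = c_w` for every such `Φ`.
* §2 `frobExponentAt_eq_zero_of_isAnticyclotomic_of_smul_eq` — `K/ℚ` Galois, `κ` anticyclotomic, `c₀ ∈ Γ_ℚ`
  outside `Γ_K` with `c̄₀ • w = w`, `w ∤ p` ⇒ `c_w = 0`; `decomp_le_kerSubgroup_of_isAnticyclotomic_of_smul_eq`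
  — then `D_w ≤ ker κ` (totally split).
* §3 the imaginary quadratic / inert form used by Kolyvagin-system bookkeeping:
  `frobExponentAt_eq_zero_of_span_natCast`, `decomp_le_kerSubgroup_of_span_natCast` — `K` imaginary quadratic,
  `κ` anticyclotomic, `w = (n) = n𝓞_K` generated by a natural number (an inert `ℓ`: `w = ℓ𝓞_K`), `w ∤ p`.

Consumer (cell `pub/bsd-print-x9`, shared μ-item of routes PrintX9/PrintX10b, road R1′, SKELETON-v9-PLAN STUB 1d): at a
Kolyvagin prime `λ = (ℓ)` the specialised module `T_{q_m} = T_pE ⊗ S_m(ψ)` restricted to `Γ_{K_λ}` has TRIVIAL twist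
(`ψ|_{D_λ} = 1`), so `I_ℓ(T_{q_m}) = I_ℓ(T_pE)·S_m` and `L_s(T_{q_m}) = L_s(T_pE)` in Howard's Def. 1.2.1. Nothing
about Selmer groups is asserted here; BSD is not proved by any of this.

References: [Brink2007] D. Brink, Math. Comp. 76 (2007), §III p. 2134 and §II Prop. 1; [Washington1997] Prop. 13.2
(`ℤ_p`-extensions are unramified outside `p`); [Marcus2018] D. Marcus, *Number Fields*, Ch. 4, Thm. 32 and the remark
after it (Frobenii above an unramified prime are conjugate); [NeukirchANT1999] Ch. I §9 (9.3)–(9.6), Ch. II §9 (9.6);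
[Howard2004HeegnerKolyvagin] §1.2 (Kolyvagin primes are inert; «`λ` splits completely in the Hilbert class field»);
[Greenberg1987] R. Greenberg, §2 («`c` acts on `Gal(K_∞⁻/K)` by `−1`»).
-/

noncomputable section

open NumberField IsDedekindDomain Field
open scoped Pointwise
open Literature.NumberTheory.GaloisRepresentations Literature.NumberTheory.Automorphic

namespace Literature.NumberTheory.EllipticCurves.ZpExtension

variable {K : Type} [Field K] [NumberField K] {p : ℕ} [Fact p.Prime] (κ : ZpExtension K p)

/-! ## §1 `κ` is constant on the arithmetic Frobenii above a place `w ∤ p` -/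

/-- **`κ Φ = κ Φ'` for arithmetic Frobenii at any two primes of `\bar ℤ_K` above the same place `w ∤ p`.** The
primes are conjugate, `𝔓' = g • 𝔓` (`exists_smul_eq_of_mem_primesAbove_holds`); `g Φ g⁻¹` is an arithmetic Frobenius at
`𝔓'` (`IsArithFrobAt.conj`), so `Φ' (gΦg⁻¹)⁻¹` lies in the inertia group of `𝔓'` (`IsArithFrobAt.mul_inv_mem_inertia`),
on which `κ` vanishes (`inertia_le_kerSubgroup_holds`: a `ℤ_p`-extension is unramified outside `p`); and `κ(gΦg⁻¹) = κ(Φ)`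
because `ℤ_p` is commutative. [cite: Marcus2018, Ch. 4, Thm. 32 and the remark after it] [cite: Washington1997, Prop. 13.2] -/
theorem apply_eq_of_isArithFrobAt {w : HeightOneSpectrum (𝓞 K)} (hw : ((p : ℕ) : 𝓞 K) ∉ w.asIdeal)
    {𝔓 𝔓' : Ideal (absIntegers (𝓞 K) K)} (h𝔓 : 𝔓 ∈ w.primesAbove) (h𝔓' : 𝔓' ∈ w.primesAbove)
    {Φ Φ' : absoluteGaloisGroup K} (hΦ : IsArithFrobAt (𝓞 K) Φ 𝔓) (hΦ' : IsArithFrobAt (𝓞 K) Φ' 𝔓') :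
    κ Φ = κ Φ' := by
  obtain ⟨g, hg⟩ := HeightOneSpectrum.exists_smul_eq_of_mem_primesAbove_holds h𝔓 h𝔓'
  have hΦ'' : IsArithFrobAt (𝓞 K) (g * Φ * g⁻¹) 𝔓' := hg ▸ hΦ.conj g
  have hI : Φ' * (g * Φ * g⁻¹)⁻¹ ∈ 𝔓'.inertia (absoluteGaloisGroup K) := hΦ'.mul_inv_mem_inertia hΦ''
  have hker : Φ' * (g * Φ * g⁻¹)⁻¹ ∈ κ.kerSubgroup := inertia_le_kerSubgroup_holds K p κ hw h𝔓' hI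
  rw [ZpExtension.mem_kerSubgroup, map_mul, map_inv, map_mul, map_mul, map_inv, mul_inv_cancel_comm,
    mul_inv_eq_one] at hker
  exact hker.symm

/-- **`κ Φ = c_w` for EVERY arithmetic Frobenius `Φ ∈ Γ_K` at ANY prime of `\bar ℤ_K` above `w ∤ p`** (`c_w =
κ.frobExponentAt w` is defined through the local Frobenius of `K_w` and the chosen embedding, i.e. through the prime
`𝔓₀ = adicCompletionPrime K w`; `isArithFrobAt_absGaloisRestrict_adicCompletionPrime_iff` and §1).
[cite: Washington1997, Prop. 13.2] [cite: NeukirchANT1999, Ch. II §9 Prop. (9.6)] -/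
theorem apply_eq_frobExponentAt_of_isArithFrobAt {w : HeightOneSpectrum (𝓞 K)} (hw : ((p : ℕ) : 𝓞 K) ∉ w.asIdeal)
    {𝔓 : Ideal (absIntegers (𝓞 K) K)} (h𝔓 : 𝔓 ∈ w.primesAbove) {Φ : absoluteGaloisGroup K}
    (hΦ : IsArithFrobAt (𝓞 K) Φ 𝔓) :
    κ Φ = Multiplicative.ofAdd (κ.frobExponentAt w) := by
  obtain ⟨φ, hφ, hκφ⟩ := κ.exists_isFrobPow_apply_localMap_eq w
  have hq : IsNonarchimedeanLocalField.residueFieldCard (w.adicCompletion K) = Nat.card (𝓞 K ⧸ w.asIdeal) := by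
    rw [residueFieldCard_adicCompletion_eq, HeightOneSpectrum.residueCard_eq_card_quotient]
  have hΦ₀ : IsArithFrobAt (𝓞 K) (absGaloisRestrict K (w.adicCompletion K) φ) (adicCompletionPrime K w) :=
    (isArithFrobAt_absGaloisRestrict_adicCompletionPrime_iff K w hq φ).mpr
      (isFrobPow_one_iff_isAbsArithFrob_holds.mp hφ)
  rw [← hκφ]
  exact κ.apply_eq_of_isArithFrobAt hw h𝔓 (adicCompletionPrime_mem_primesAbove K w) hΦ hΦ₀

/-! ## §2 A Galois-stable place is totally split in an anticyclotomic `ℤ_p`-extension -/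

section Galois

variable [IsGalois ℚ K]

/-- **`c_w = 0` at a `Gal(K/ℚ)`-stable place `w ∤ p` of an anticyclotomic `ℤ_p`-extension.** For `c₀ ∈ Γ_ℚ` outside
`Γ_K` with `c̄₀ • w = w`: an arithmetic Frobenius `Φ` at `𝔓₀ ∣ w` is carried by the outer conjugation `θ_{c₀}` to an
arithmetic Frobenius at `c₀ ⋆ 𝔓₀ ∣ c̄₀ • w = w`, so `κ(θ_{c₀} Φ) = c_w` (§1) while anticyclotomy gives
`κ(θ_{c₀} Φ) = κ(Φ)⁻¹`; hence `2 c_w = 0` in the torsion-free `ℤ_p`. [cite: Brink2007, §III p. 2134 and §II Prop. 1]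
[cite: Greenberg1987, §2] -/
theorem frobExponentAt_eq_zero_of_isAnticyclotomic_of_smul_eq (hκ : κ.IsAnticyclotomic)
    {c₀ : absoluteGaloisGroup ℚ} (hc₀ : c₀ ∉ Set.range (absGaloisRestrict ℚ K))
    {w : HeightOneSpectrum (𝓞 K)} (hw : ((p : ℕ) : 𝓞 K) ∉ w.asIdeal) (hcw : absGaloisQuot ℚ K c₀ • w = w) :
    κ.frobExponentAt w = 0 := by
  obtain ⟨φ, hφ, hκφ⟩ := κ.exists_isFrobPow_apply_localMap_eq w
  set Φ : absoluteGaloisGroup K := absGaloisRestrict K (w.adicCompletion K) φ with hΦdef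
  have hq : IsNonarchimedeanLocalField.residueFieldCard (w.adicCompletion K) = Nat.card (𝓞 K ⧸ w.asIdeal) := by
    rw [residueFieldCard_adicCompletion_eq, HeightOneSpectrum.residueCard_eq_card_quotient]
  have hΦ : IsArithFrobAt (𝓞 K) Φ (adicCompletionPrime K w) :=
    (isArithFrobAt_absGaloisRestrict_adicCompletionPrime_iff K w hq φ).mpr
      (isFrobPow_one_iff_isAbsArithFrob_holds.mp hφ)
  -- the conjugate Frobenius sits above `c̄₀ • w = w`
  have h𝔓' : outerConjIdeal c₀ (adicCompletionPrime K w) ∈ w.primesAbove := by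
    have h := outerConjIdeal_mem_primesAbove (F := ℚ) (adicCompletionPrime_mem_primesAbove K w) c₀
    rwa [hcw] at h
  have hΦ' : IsArithFrobAt (𝓞 K) (absGaloisOuterConj ℚ K c₀ Φ) (outerConjIdeal c₀ (adicCompletionPrime K w)) :=
    (isArithFrobAt_absGaloisOuterConj_iff (adicCompletionPrime_mem_primesAbove K w) c₀ Φ).mpr hΦ
  -- same value (§1) and inverse value (anticyclotomy)
  have hsame : κ (absGaloisOuterConj ℚ K c₀ Φ) = κ Φ :=
    κ.apply_eq_of_isArithFrobAt hw h𝔓' (adicCompletionPrime_mem_primesAbove K w) hΦ' hΦ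
  have hinv : κ (absGaloisOuterConj ℚ K c₀ Φ) = (κ Φ)⁻¹ :=
    hκ Φ _ c₀ hc₀ (absGaloisRestrict_absGaloisOuterConj ℚ K c₀ Φ)
  have hsq : κ Φ * κ Φ = 1 := by
    rw [hsame] at hinv
    calc κ Φ * κ Φ = (κ Φ)⁻¹ * κ Φ := by rw [← hinv]
      _ = 1 := inv_mul_cancel _
  -- `c_w = toAdd (κ Φ)` and `2 c_w = 0`
  have hc : κ Φ = Multiplicative.ofAdd (κ.frobExponentAt w) := hκφ
  have h2 : κ.frobExponentAt w + κ.frobExponentAt w = 0 := by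
    have := congrArg Multiplicative.toAdd hsq
    rwa [toAdd_mul, toAdd_one, hc, toAdd_ofAdd] at this
  exact add_self_eq_zero.mp h2

/-- **A `Gal(K/ℚ)`-stable place `w ∤ p` is TOTALLY SPLIT in an anticyclotomic `ℤ_p`-extension: `D_w ≤ ker κ`.**
[cite: Brink2007, §III p. 2134] [cite: Washington1997, Prop. 13.2] -/
theorem decomp_le_kerSubgroup_of_isAnticyclotomic_of_smul_eq (hκ : κ.IsAnticyclotomic)
    {c₀ : absoluteGaloisGroup ℚ} (hc₀ : c₀ ∉ Set.range (absGaloisRestrict ℚ K))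
    {w : HeightOneSpectrum (𝓞 K)} (hw : ((p : ℕ) : 𝓞 K) ∉ w.asIdeal) (hcw : absGaloisQuot ℚ K c₀ • w = w) :
    GreenbergSelmer.decomp w ≤ κ.kerSubgroup :=
  κ.decomp_le_kerSubgroup_of_frobExponentAt_eq_zero hw
    (κ.frobExponentAt_eq_zero_of_isAnticyclotomic_of_smul_eq hκ hc₀ hw hcw)

end Galois

/-! ## §3 The inert form: `w = (n)` generated by a natural number, `K` imaginary quadratic -/

/-- A place generated by a natural number is fixed by every automorphism of `K`. [folklore] -/
private theorem smul_eq_of_span_natCast (g : K ≃ₐ[ℚ] K) {w : HeightOneSpectrum (𝓞 K)} {n : ℕ}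
    (hn : w.asIdeal = Ideal.span {(n : 𝓞 K)}) : g • w = w := by
  apply HeightOneSpectrum.ext
  rw [HeightOneSpectrum.smul_asIdeal, hn, Ideal.pointwise_smul_def, Ideal.map_span, Set.image_singleton,
    map_natCast]

/-- **An imaginary quadratic field has an element of `Γ_ℚ` outside `Γ_K`** (a lift of complex conjugation /
of the non-trivial automorphism). [folklore] -/
private theorem exists_not_mem_range_absGaloisRestrict (hK : IsImaginaryQuadratic K) :
    ∃ c₀ : absoluteGaloisGroup ℚ, c₀ ∉ Set.range (absGaloisRestrict ℚ K) := by
  haveI : Algebra.IsQuadraticExtension ℚ K := ⟨hK.1⟩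
  -- a non-trivial automorphism of `K`
  have hcard : Nat.card (K ≃ₐ[ℚ] K) = 2 := by rw [IsGalois.card_aut_eq_finrank, hK.1]
  obtain ⟨g, hg⟩ : ∃ g : K ≃ₐ[ℚ] K, g ≠ 1 := by
    by_contra h
    push Not at h
    haveI : Subsingleton (K ≃ₐ[ℚ] K) := ⟨fun a b => by rw [h a, h b]⟩
    have : Nat.card (K ≃ₐ[ℚ] K) ≤ 1 := Finite.card_le_one_iff_subsingleton.mpr inferInstance
    omega
  obtain ⟨c₀, hc₀⟩ := absGaloisQuot_surjective ℚ K g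
  refine ⟨c₀, fun hmem => hg ?_⟩
  rw [← hc₀]
  exact (absGaloisQuot_eq_one_iff ℚ K c₀).mpr hmem

/-- **`c_λ = 0` at `λ = (n) = n𝓞_K`, `λ ∤ p`, for an anticyclotomic `ℤ_p`-extension of an imaginary quadratic `K`**
— in particular at every INERT rational prime `ℓ ≠ p` (`λ = ℓ𝓞_K`): the prime `λ` splits totally in `K_∞`
(Brink; «`Ψ(Frob_λ) = 1`» at inert places, Pollack–Weston Lemma 3.2 / Jetchev–Skinner–Wan §5.1).
[cite: Brink2007, §III p. 2134 and §II Prop. 1] [cite: Greenberg1987, §2] -/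
theorem frobExponentAt_eq_zero_of_span_natCast (hK : IsImaginaryQuadratic K) (hκ : κ.IsAnticyclotomic)
    {w : HeightOneSpectrum (𝓞 K)} (hw : ((p : ℕ) : 𝓞 K) ∉ w.asIdeal) {n : ℕ}
    (hn : w.asIdeal = Ideal.span {(n : 𝓞 K)}) :
    κ.frobExponentAt w = 0 := by
  haveI : Algebra.IsQuadraticExtension ℚ K := ⟨hK.1⟩
  obtain ⟨c₀, hc₀⟩ := exists_not_mem_range_absGaloisRestrict hK
  exact κ.frobExponentAt_eq_zero_of_isAnticyclotomic_of_smul_eq hκ hc₀ hw (smul_eq_of_span_natCast _ hn)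

/-- **`D_λ ≤ ker κ` at `λ = (n) = n𝓞_K`, `λ ∤ p` — an inert Kolyvagin prime `λ = ℓ𝓞_K` splits completely in the
anticyclotomic `ℤ_p`-extension**, so a twist `T ⊗ S(ψ)` by a character `ψ` of `Γ = Γ_K/ker κ` is UNTWISTED on `Γ_{K_λ}`.
[cite: Brink2007, §III p. 2134] [cite: Howard2004HeegnerKolyvagin, §1.2 (Def. 1.2.1, Kolyvagin primes)] -/
theorem decomp_le_kerSubgroup_of_span_natCast (hK : IsImaginaryQuadratic K) (hκ : κ.IsAnticyclotomic)
    {w : HeightOneSpectrum (𝓞 K)} (hw : ((p : ℕ) : 𝓞 K) ∉ w.asIdeal) {n : ℕ}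
    (hn : w.asIdeal = Ideal.span {(n : 𝓞 K)}) :
    GreenbergSelmer.decomp w ≤ κ.kerSubgroup :=
  κ.decomp_le_kerSubgroup_of_frobExponentAt_eq_zero hw (κ.frobExponentAt_eq_zero_of_span_natCast hK hκ hw hn)

end Literature.NumberTheory.EllipticCurves.ZpExtension

end
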